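import Summits.QuantumFields.YangMills.Theorems.CovariantDischargePlaquetteTransport
import Summits.QuantumFields.YangMills.Theorems.CovariantDischargeUniformFluxLetters
import Literature.MathematicalPhysics.QuantumFieldTheory.Balaban1983to89.B15Prop1ChartCalculusSU2
import Literature.MathematicalPhysics.QuantumFieldTheory.Balaban1983to89.B15Prop1DatumGaugeNormalisation
import HarnessLib

/-!
# Line «sandwich_discharge» on crux `HistoryTailL` (stmt-QuantumFields-19936), stub `stub_sandwichSweepGapCapped` — remainder (r2):
# FRAMED PLAQUETTE TRANSPORT — the frame defect of a covariantly framed one-axis sweep is paid by the three frame loops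

Cell `ym3-torus` (YM ladder rung R3 = continuum SU(2) Yang–Mills on the three-torus — a RUNG, NOT the Clay problem: not d = 4, not
infinite volume, not a mass gap), width seat `ym-ust-19936-w5` gen 14, helper letters `--supports stmt-QuantumFields-19936`.

The architecture of record for the capped sweep stub (px8 g6 `ARCH-SPRIME` §2/§6) sweeps the fine field by left translations
`U_b ↦ h_b·U_b`, `h_b = exp(c_b·X_b(U))`, whose AXES are COVARIANTLY FRAMED: `X_b(U) = Ad_{G_b}(n̂₀)` with `G_b ∈ SU(2)` the parallel
transport of `U` from the source of `b` to a centre along a tree (the directions read tree links only, ✓`CovariantDischargeSweepSimultaneous`).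
✓`CovariantDischargePlaquetteTransport` gives, per plaquette, the EXACT identity `U′(∂q) = T·U(∂q)` with the transported product
`T = h₁ · U₁h₂U₁⁻¹ · (U₁U₂U₃⁻¹)h₃⁻¹(U₁U₂U₃⁻¹)⁻¹ · U(∂q)h₄⁻¹U(∂q)⁻¹`, the cost/torque split for a PERFECT one-axis transport
`T₀ = exp(s·n̂)` and, for imperfect frames, the defect letter `|Δ_T − Δ_{T₀}| ≤ ‖su2Quat T − su2Quat T₀‖` — leaving the size of that defect
to «the frame bookkeeping of the capped stub» (ARCH §6 (r2): `def_q ≤ |a|_{∂q}·η_R`, «misalignment of tree frames across q = a loop of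
diameter ≤ 2R»).  THIS FILE is that bookkeeping, as pure group algebra:

* §1 (any `GaugeGroup`): telescoping `dist1((x₁x₂x₃x₄)(y₁y₂y₃y₄)⁻¹) ≤ Σ dist1(xᵢyᵢ⁻¹)` and the conjugation identity
  `(KeK⁻¹)(GeG⁻¹)⁻¹ = G·[G⁻¹K, e]·G⁻¹` (`dist1` of two transports of the SAME element = `dist1` of a group commutator).
* §2 (`SU(2)`, quaternion model): the chord identity `‖su2Quat A − su2Quat B‖ = dist1(AB⁻¹)` (private) and the COMMUTATOR ESTIMATE
  ★`dist1(g e g⁻¹ e⁻¹) ≤ 2·dist1 g·dist1 e`.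
* §3 (`SU(2)`, framed one-axis translations `hᵢ = expPoint(cᵢ • Ad_{Gᵢ} n̂₀) = Gᵢ·expPoint(cᵢ•n̂₀)·Gᵢ⁻¹`, lit ✓`iexp_adSU2`):
  ★★`dist1_framedTransport_mul_inv_oneAxis_le` — `dist1(T·T₀⁻¹) ≤ 2(|c₂|·dist1(G₁⁻¹U₁G₂) + |c₃|·dist1(G₁⁻¹(U₁U₂U₃⁻¹)G₃) + |c₄|·dist1(G₁⁻¹U(∂q)G₄))`
  with `T₀ = expPoint((c₁+c₂−c₃−c₄) • Ad_{G₁} n̂₀)`: the defect is carried by the three FRAME LOOPS (transport to a neighbouring corner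
  along the frames and back along `∂q`), each multiplied by the amplitude it misaligns; and the per-plaquette consequence
  ★★★`abs_wilsonTerm_plaq_framed_sub_le`:
  `|[(1 − reTr U′(∂q)) − (1 − reTr U(∂q))] − [(1 − cos s)·reTr U(∂q) + sin s·⟨Ad_{G₁}n̂₀, imVec(su2Quat U(∂q))⟩]| ≤ 2(|c₂|d₂ + |c₃|d₃ + |c₄|d₄)`,
  `s = c₁+c₂−c₃−c₄` — sharp cost + torque + frame defect, with NO further second-order remainder.
* §4 frames from a gauge `u` (`Gᵧ = u(y)⁻¹`, e.g. the axial/comb gauge of the sweep ball): the three loops ARE the letters of the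
  re-gauged field `U^u` — `d₂ = dist1(U^u(b₁))`, `d₃ = dist1(U^u(b₁)U^u(b₂)U^u(b₃)⁻¹)`, `d₄ = dist1(U(∂q))` (★★`abs_wilsonTerm_plaq_gaugeFramed_sub_le`),
  so under a crude Stokes bound `dist1 ≤ η` on the re-gauged links of the ball the defect is `≤ 2(|c₂| + 3|c₃| + |c₄|)·η`-class
  (`abs_wilsonTerm_plaq_gaugeFramed_sub_le_of_links`); and the READING COVARIANCE `⟨Ad_G n̂₀, imVec(su2Quat W)⟩ = ⟨n̂₀, imVec(su2Quat(G⁻¹WG))⟩`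
  (the torque in the transported frame = the reading, in the fixed centre frame, of the plaquette transported to the centre).

WHAT THIS IS NOT.  Per-plaquette algebra: no profile `a`, no cutoff, no Green kernel, no tree is constructed, no `η_R` is chosen, no sum
over plaquettes is taken; nothing of `stub_sandwichSweepGapCapped`, `stub_sandwichDeep`, the crux `HistoryTailL`, the rung R3, d = 4, a
continuum limit or a mass gap is proved.  YM₃ on T³ is rung R3, NOT the Clay problem.

References: T. Bałaban, CMP **98** (1985) 17–51 [Balaban1985Averaging] ((8)–(9) p.19: gauge transformations and plaquette variables);
CMP **122** (1989) 175–202 [Balaban1989LargeFieldI] ((1.77) p.194: the adjoint action / gauge covariance in the `SU(2)` chart);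
CMP **109** (1987) 249–301 [Balaban1987RG1] ((0.2) p.252 the Wilson action).  Everything here is elementary group/quaternion algebra ([folklore]).
-/

noncomputable section

open scoped Quaternion RealInnerProductSpace
open Literature.MathematicalPhysics.QuantumLattice (su2Quat norm_su2Quat su2Quat_ne_zero)
open Literature.MathematicalPhysics.QuantumFieldTheory.Balaban1983to89
open Literature.MathematicalPhysics.QuantumFieldTheory.Balaban1983to89.T4HaarSU2Translate (su2Quat_mul su2Quat_one)
open Literature.MathematicalPhysics.QuantumFieldTheory.Balaban1983to89.T4CubeChartGnomonic (SU2)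
open Literature.MathematicalPhysics.QuantumFieldTheory.Balaban1983to89.T4HaarSU2ExpChart (imQuat expPoint norm_imQuat)
open Literature.MathematicalPhysics.QuantumFieldTheory.Balaban1983to89.T4ExpWindowSmallField
  (imVec dist1_eq_norm_su2Quat_sub_one dist1_expPoint_le)
open Literature.MathematicalPhysics.QuantumFieldTheory.Balaban1983to89.T4WilsonLinkAffine (bond₁ bond₂ bond₃ bond₄ su2Quat_inv)
open Literature.MathematicalPhysics.QuantumFieldTheory.Balaban1983to89.B15Prop1ChartSU2 (adSU2 adSU2_apply iexp_adSU2 su2Chart_iexp)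
open Literature.MathematicalPhysics.QuantumFieldTheory.Balaban1983to89.B15Prop1ChartCalculusSU2 (imQuat_adSU2 adSU2_adSU2 adSU2_one_apply)
open Literature.MathematicalPhysics.QuantumFieldTheory.Balaban1983to89.B15Prop1DatumGaugeNormalisation (norm_adSU2_eq)
open Summit.QuantumFields.YangMills.Theorems.CovariantDischargeUniformFluxLetters (expPoint_add_smul expPoint_neg_smul)
open Summit.QuantumFields.YangMills.Theorems.CovariantDischargePlaquetteTransport
  (plaqHol_of_mul_left abs_wilsonTerm_plaq_sub_oneAxis_le wilsonTerm_expPoint_mul_sub)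
open Summit.QuantumFields.YangMills.Theorems.CovariantDischargeOneLinkIncrement (re_imQuat_mul)

namespace Summit.QuantumFields.YangMills.Theorems.CovariantDischargeFramedPlaquetteTransport

/-! ## §1 Any gauge group: telescoping against a reference product; two transports of one element -/

section AnyGroup

variable {G : Type*} [GaugeGroup G]

/-- Telescoping, two factors: `dist1((x₁x₂)(y₁y₂)⁻¹) ≤ dist1(x₁y₁⁻¹) + dist1(x₂y₂⁻¹)`
(`x₁x₂y₂⁻¹y₁⁻¹ = (x₁y₁⁻¹)·y₁(x₂y₂⁻¹)y₁⁻¹` and conjugation invariance; also landed elsewhere in the tree as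
`FibreClashWitness.dist1_mul_mul_inv_le`, kept private here to avoid a cross-lane import). [folklore] -/
private theorem dist1_mul_mul_inv_mul_le (x₁ x₂ y₁ y₂ : G) :
    dist1 (x₁ * x₂ * (y₁ * y₂)⁻¹) ≤ dist1 (x₁ * y₁⁻¹) + dist1 (x₂ * y₂⁻¹) := by
  have e : x₁ * x₂ * (y₁ * y₂)⁻¹ = (x₁ * y₁⁻¹) * (y₁ * (x₂ * y₂⁻¹) * y₁⁻¹) := by group
  rw [e]
  exact (GaugeGroup.dist1_mul_le _ _).trans (by rw [GaugeGroup.dist1_conj])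

/-- Telescoping, four factors: `dist1((x₁x₂x₃x₄)(y₁y₂y₃y₄)⁻¹) ≤ Σᵢ dist1(xᵢyᵢ⁻¹)`. [folklore] -/
theorem dist1_prod_four_mul_inv_le (x₁ x₂ x₃ x₄ y₁ y₂ y₃ y₄ : G) :
    dist1 (x₁ * x₂ * x₃ * x₄ * (y₁ * y₂ * y₃ * y₄)⁻¹) ≤
      dist1 (x₁ * y₁⁻¹) + dist1 (x₂ * y₂⁻¹) + dist1 (x₃ * y₃⁻¹) + dist1 (x₄ * y₄⁻¹) := by
  have h4 := dist1_mul_mul_inv_mul_le (x₁ * x₂ * x₃) x₄ (y₁ * y₂ * y₃) y₄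
  have h3 := dist1_mul_mul_inv_mul_le (x₁ * x₂) x₃ (y₁ * y₂) y₃
  have h2 := dist1_mul_mul_inv_mul_le x₁ x₂ y₁ y₂
  linarith

/-- Two transports of the SAME element differ by a conjugated commutator:
`(KeK⁻¹)(GeG⁻¹)⁻¹ = G·((G⁻¹K) e (G⁻¹K)⁻¹ e⁻¹)·G⁻¹`. [folklore] -/
theorem conj_mul_conj_inv_eq (K G₀ e : G) :
    (K * e * K⁻¹) * (G₀ * e * G₀⁻¹)⁻¹ = G₀ * ((G₀⁻¹ * K) * e * (G₀⁻¹ * K)⁻¹ * e⁻¹) * G₀⁻¹ := by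
  group

/-- … hence `dist1((KeK⁻¹)(GeG⁻¹)⁻¹) = dist1((G⁻¹K) e (G⁻¹K)⁻¹ e⁻¹)` — the frame mismatch `G⁻¹K` enters only through a commutator
with the translated element. [folklore] -/
theorem dist1_conj_mul_conj_inv_eq (K G₀ e : G) :
    dist1 ((K * e * K⁻¹) * (G₀ * e * G₀⁻¹)⁻¹) = dist1 ((G₀⁻¹ * K) * e * (G₀⁻¹ * K)⁻¹ * e⁻¹) := by
  rw [conj_mul_conj_inv_eq, GaugeGroup.dist1_conj]

/-- Re-bracketing a transported conjugate: `U·(G e G⁻¹)·U⁻¹ = (UG)·e·(UG)⁻¹`. [folklore] -/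
theorem mul_conj_mul_inv_eq (U G₀ e : G) : U * (G₀ * e * G₀⁻¹) * U⁻¹ = (U * G₀) * e * (U * G₀)⁻¹ := by
  group

/-- Re-bracketing a transported inverse conjugate: `T·(G e G⁻¹)⁻¹·T⁻¹ = (TG)·e⁻¹·(TG)⁻¹`. [folklore] -/
theorem mul_conj_inv_mul_inv_eq (T G₀ e : G) : T * (G₀ * e * G₀⁻¹)⁻¹ * T⁻¹ = (T * G₀) * e⁻¹ * (T * G₀)⁻¹ := by
  group

/-- Conjugation distributes over the plaquette pattern: `G(e₁e₂e₃⁻¹e₄⁻¹)G⁻¹ = (Ge₁G⁻¹)(Ge₂G⁻¹)(Ge₃⁻¹G⁻¹)(Ge₄⁻¹G⁻¹)`. [folklore] -/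
theorem conj_plaqPattern_eq (G₀ e₁ e₂ e₃ e₄ : G) :
    G₀ * (e₁ * e₂ * e₃⁻¹ * e₄⁻¹) * G₀⁻¹ =
      (G₀ * e₁ * G₀⁻¹) * (G₀ * e₂ * G₀⁻¹) * (G₀ * e₃⁻¹ * G₀⁻¹) * (G₀ * e₄⁻¹ * G₀⁻¹) := by
  group

end AnyGroup

/-! ## §2 `SU(2)`: chord distance and the commutator estimate in the quaternion model -/

section SU2Quat

/-- `su2Quat g · star(su2Quat g) = 1` (unit quaternion). [folklore] -/
private theorem su2Quat_mul_star_self (g : SU2) : su2Quat g * star (su2Quat g) = 1 := by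
  rw [Quaternion.self_mul_star, Quaternion.normSq_eq_norm_mul_self, norm_su2Quat, mul_one, Quaternion.coe_one]

/-- **CHORD DISTANCE** in the quaternion model: `‖su2Quat A − su2Quat B‖ = dist1(A·B⁻¹)` (also landed elsewhere in the tree as
`FlatRatioTermination.Skeleton.norm_su2Quat_sub`, kept private here to avoid a cross-lane import). [folklore] -/
private theorem norm_su2Quat_sub_su2Quat (A B : SU2) : ‖su2Quat A - su2Quat B‖ = dist1 (A * B⁻¹) := by
  rw [dist1_eq_norm_su2Quat_sub_one, su2Quat_mul, su2Quat_inv]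
  have e : su2Quat A * star (su2Quat B) - 1 = (su2Quat A - su2Quat B) * star (su2Quat B) := by
    rw [sub_mul, su2Quat_mul_star_self]
  rw [e, norm_mul, Quaternion.norm_star, norm_su2Quat, mul_one]

/-- ★ **COMMUTATOR ESTIMATE** in `SU(2)`: `dist1(g e g⁻¹ e⁻¹) ≤ 2·dist1 g·dist1 e`
(`[g,e] − 1 = (ge − eg)g⁻¹e⁻¹` and `ge − eg = (g−1)(e−1) − (e−1)(g−1)`, in unit quaternions). [folklore] -/
theorem dist1_comm_le (g e : SU2) : dist1 (g * e * g⁻¹ * e⁻¹) ≤ 2 * dist1 g * dist1 e := by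
  rw [dist1_eq_norm_su2Quat_sub_one, dist1_eq_norm_su2Quat_sub_one, dist1_eq_norm_su2Quat_sub_one,
    su2Quat_mul, su2Quat_mul, su2Quat_mul, su2Quat_inv, su2Quat_inv]
  have ha := su2Quat_mul_star_self g
  have hb := su2Quat_mul_star_self e
  have h2 : su2Quat e * su2Quat g * star (su2Quat g) * star (su2Quat e) = 1 := by
    rw [mul_assoc (su2Quat e), ha, mul_one, hb]
  have e1 : su2Quat g * su2Quat e * star (su2Quat g) * star (su2Quat e) - 1 =
      ((su2Quat g - 1) * (su2Quat e - 1) - (su2Quat e - 1) * (su2Quat g - 1)) * (star (su2Quat g) * star (su2Quat e)) := by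
    have e0 : su2Quat g * su2Quat e * star (su2Quat g) * star (su2Quat e) - 1 =
        su2Quat g * su2Quat e * star (su2Quat g) * star (su2Quat e) -
          su2Quat e * su2Quat g * star (su2Quat g) * star (su2Quat e) := by
      rw [h2]
    rw [e0]
    noncomm_ring
  rw [e1]
  calc ‖((su2Quat g - 1) * (su2Quat e - 1) - (su2Quat e - 1) * (su2Quat g - 1)) * (star (su2Quat g) * star (su2Quat e))‖
      ≤ ‖(su2Quat g - 1) * (su2Quat e - 1) - (su2Quat e - 1) * (su2Quat g - 1)‖ * ‖star (su2Quat g) * star (su2Quat e)‖ :=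
        norm_mul_le _ _
    _ ≤ (‖su2Quat g - 1‖ * ‖su2Quat e - 1‖ + ‖su2Quat e - 1‖ * ‖su2Quat g - 1‖) * 1 := by
        gcongr
        · exact (norm_sub_le _ _).trans (add_le_add (norm_mul_le _ _) (norm_mul_le _ _))
        · rw [norm_mul, Quaternion.norm_star, Quaternion.norm_star, norm_su2Quat, norm_su2Quat, mul_one]
    _ = 2 * ‖su2Quat g - 1‖ * ‖su2Quat e - 1‖ := by ring

/-- Two transports of the same element in `SU(2)`: `dist1((KeK⁻¹)(GeG⁻¹)⁻¹) ≤ 2·dist1(G⁻¹K)·dist1 e`. [folklore] -/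
theorem dist1_conj_mul_conj_inv_le (K G₀ e : SU2) :
    dist1 ((K * e * K⁻¹) * (G₀ * e * G₀⁻¹)⁻¹) ≤ 2 * dist1 (G₀⁻¹ * K) * dist1 e := by
  rw [dist1_conj_mul_conj_inv_eq]
  exact dist1_comm_le _ _

end SU2Quat

/-! ## §3 `SU(2)`: framed one-axis translations and the frame-defect letter -/

section Framed

/-- **Ad-COVARIANCE OF THE ONE-AXIS TRANSLATION**: `expPoint(c • Ad_G n) = G·expPoint(c•n)·G⁻¹` (lit ✓`iexp_adSU2`, `Ad_G` linear).
[cite: Balaban1989LargeFieldI, (1.77) p.194] -/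
theorem expPoint_smul_adSU2 (G₀ : SU2) (c : ℝ) (n : EuclideanSpace ℝ (Fin 3)) :
    expPoint (c • adSU2 G₀ n) = G₀ * expPoint (c • n) * G₀⁻¹ := by
  rw [← LinearMap.map_smul]
  have h := iexp_adSU2 G₀ (c • n)
  simpa only [su2Chart_iexp] using h

/-- `dist1(expPoint(c•n)) ≤ |c|` for a unit axis `n` (chord ≤ arc). [folklore] -/
theorem dist1_expPoint_smul_le {n : EuclideanSpace ℝ (Fin 3)} (hn : ‖n‖ = 1) (c : ℝ) :
    dist1 (expPoint (c • n)) ≤ |c| := by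
  have h := dist1_expPoint_le (c • n)
  rwa [norm_smul, hn, mul_one, Real.norm_eq_abs] at h

/-- One-parameter subgroup, plaquette pattern: `e^{c₁n}·e^{c₂n}·(e^{c₃n})⁻¹·(e^{c₄n})⁻¹ = e^{(c₁+c₂−c₃−c₄)n}`. [folklore] -/
theorem expPoint_smul_plaqPattern (c₁ c₂ c₃ c₄ : ℝ) (n : EuclideanSpace ℝ (Fin 3)) :
    expPoint (c₁ • n) * expPoint (c₂ • n) * (expPoint (c₃ • n))⁻¹ * (expPoint (c₄ • n))⁻¹ =
      expPoint ((c₁ + c₂ - c₃ - c₄) • n) := by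
  have e : c₁ + c₂ - c₃ - c₄ = c₁ + c₂ + (-c₃) + (-c₄) := by ring
  rw [e, expPoint_add_smul, expPoint_add_smul, expPoint_add_smul, expPoint_neg_smul, expPoint_neg_smul]

/-- ★★ **THE FRAME-DEFECT LETTER (group form).**  For framed one-axis translations `hᵢ = expPoint(cᵢ • Ad_{Gᵢ} n̂₀)` (`‖n̂₀‖ = 1`)
on the four letters of a plaquette with partial transports `U₁`, `T₃ = U₁U₂U₃⁻¹`, `T₄ = U(∂q)`, the transported product
`T = h₁ · U₁h₂U₁⁻¹ · T₃h₃⁻¹T₃⁻¹ · T₄h₄⁻¹T₄⁻¹` is within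
`2(|c₂|·dist1(G₁⁻¹U₁G₂) + |c₃|·dist1(G₁⁻¹T₃G₃) + |c₄|·dist1(G₁⁻¹T₄G₄))` of the perfect one-axis rotation
`T₀ = expPoint((c₁+c₂−c₃−c₄) • Ad_{G₁} n̂₀)` (in `dist1(T·T₀⁻¹)`): each factor is `Kᵢ·e^{±cᵢn̂₀}·Kᵢ⁻¹` with `Kᵢ ∈ {G₁, U₁G₂, T₃G₃, T₄G₄}`,
the reference is `G₁·(Π e^{±cᵢn̂₀})·G₁⁻¹`, and §1–§2 apply factor by factor. [cite: Balaban1989LargeFieldI, (1.77) p.194] -/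
theorem dist1_framedTransport_mul_inv_oneAxis_le (U₁ T₃ T₄ G₁ G₂ G₃ G₄ : SU2) {n : EuclideanSpace ℝ (Fin 3)} (hn : ‖n‖ = 1)
    (c₁ c₂ c₃ c₄ : ℝ) :
    dist1 ((expPoint (c₁ • adSU2 G₁ n) * (U₁ * expPoint (c₂ • adSU2 G₂ n) * U₁⁻¹) *
        (T₃ * (expPoint (c₃ • adSU2 G₃ n))⁻¹ * T₃⁻¹) * (T₄ * (expPoint (c₄ • adSU2 G₄ n))⁻¹ * T₄⁻¹)) *
        (expPoint ((c₁ + c₂ - c₃ - c₄) • adSU2 G₁ n))⁻¹) ≤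
      2 * (|c₂| * dist1 (G₁⁻¹ * U₁ * G₂) + |c₃| * dist1 (G₁⁻¹ * T₃ * G₃) + |c₄| * dist1 (G₁⁻¹ * T₄ * G₄)) := by
  have h₁ : expPoint (c₁ • adSU2 G₁ n) = G₁ * expPoint (c₁ • n) * G₁⁻¹ := expPoint_smul_adSU2 _ _ _
  have h₂ : U₁ * expPoint (c₂ • adSU2 G₂ n) * U₁⁻¹ = (U₁ * G₂) * expPoint (c₂ • n) * (U₁ * G₂)⁻¹ := by
    rw [expPoint_smul_adSU2, mul_conj_mul_inv_eq]
  have h₃ : T₃ * (expPoint (c₃ • adSU2 G₃ n))⁻¹ * T₃⁻¹ = (T₃ * G₃) * (expPoint (c₃ • n))⁻¹ * (T₃ * G₃)⁻¹ := by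
    rw [expPoint_smul_adSU2, mul_conj_inv_mul_inv_eq]
  have h₄ : T₄ * (expPoint (c₄ • adSU2 G₄ n))⁻¹ * T₄⁻¹ = (T₄ * G₄) * (expPoint (c₄ • n))⁻¹ * (T₄ * G₄)⁻¹ := by
    rw [expPoint_smul_adSU2, mul_conj_inv_mul_inv_eq]
  have hR : expPoint ((c₁ + c₂ - c₃ - c₄) • adSU2 G₁ n) =
      (G₁ * expPoint (c₁ • n) * G₁⁻¹) * (G₁ * expPoint (c₂ • n) * G₁⁻¹) * (G₁ * (expPoint (c₃ • n))⁻¹ * G₁⁻¹) *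
        (G₁ * (expPoint (c₄ • n))⁻¹ * G₁⁻¹) := by
    rw [expPoint_smul_adSU2, ← expPoint_smul_plaqPattern, conj_plaqPattern_eq]
  rw [h₁, h₂, h₃, h₄, hR]
  refine (dist1_prod_four_mul_inv_le _ _ _ _ _ _ _ _).trans ?_
  have t₁ : dist1 ((G₁ * expPoint (c₁ • n) * G₁⁻¹) * (G₁ * expPoint (c₁ • n) * G₁⁻¹)⁻¹) = 0 := by
    rw [mul_inv_cancel, GaugeGroup.dist1_one]
  have t₂ := dist1_conj_mul_conj_inv_le (U₁ * G₂) G₁ (expPoint (c₂ • n))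
  have t₃ := dist1_conj_mul_conj_inv_le (T₃ * G₃) G₁ ((expPoint (c₃ • n))⁻¹)
  have t₄ := dist1_conj_mul_conj_inv_le (T₄ * G₄) G₁ ((expPoint (c₄ • n))⁻¹)
  have d₂ : dist1 (expPoint (c₂ • n)) ≤ |c₂| := dist1_expPoint_smul_le hn c₂
  have d₃ : dist1 ((expPoint (c₃ • n))⁻¹) ≤ |c₃| := by
    rw [GaugeGroup.dist1_inv]; exact dist1_expPoint_smul_le hn c₃
  have d₄ : dist1 ((expPoint (c₄ • n))⁻¹) ≤ |c₄| := by
    rw [GaugeGroup.dist1_inv]; exact dist1_expPoint_smul_le hn c₄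
  have a₂ : G₁⁻¹ * (U₁ * G₂) = G₁⁻¹ * U₁ * G₂ := (mul_assoc _ _ _).symm
  have a₃ : G₁⁻¹ * (T₃ * G₃) = G₁⁻¹ * T₃ * G₃ := (mul_assoc _ _ _).symm
  have a₄ : G₁⁻¹ * (T₄ * G₄) = G₁⁻¹ * T₄ * G₄ := (mul_assoc _ _ _).symm
  rw [a₂] at t₂
  rw [a₃] at t₃
  rw [a₄] at t₄
  have n₂ : 0 ≤ 2 * dist1 (G₁⁻¹ * U₁ * G₂) := mul_nonneg zero_le_two (GaugeGroup.dist1_nonneg _)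
  have n₃ : 0 ≤ 2 * dist1 (G₁⁻¹ * T₃ * G₃) := mul_nonneg zero_le_two (GaugeGroup.dist1_nonneg _)
  have n₄ : 0 ≤ 2 * dist1 (G₁⁻¹ * T₄ * G₄) := mul_nonneg zero_le_two (GaugeGroup.dist1_nonneg _)
  have m₂ : 2 * dist1 (G₁⁻¹ * U₁ * G₂) * dist1 (expPoint (c₂ • n)) ≤ 2 * dist1 (G₁⁻¹ * U₁ * G₂) * |c₂| :=
    mul_le_mul_of_nonneg_left d₂ n₂
  have m₃ : 2 * dist1 (G₁⁻¹ * T₃ * G₃) * dist1 ((expPoint (c₃ • n))⁻¹) ≤ 2 * dist1 (G₁⁻¹ * T₃ * G₃) * |c₃| :=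
    mul_le_mul_of_nonneg_left d₃ n₃
  have m₄ : 2 * dist1 (G₁⁻¹ * T₄ * G₄) * dist1 ((expPoint (c₄ • n))⁻¹) ≤ 2 * dist1 (G₁⁻¹ * T₄ * G₄) * |c₄| :=
    mul_le_mul_of_nonneg_left d₄ n₄
  have key : dist1 (G₁ * expPoint (c₁ • n) * G₁⁻¹ * (G₁ * expPoint (c₁ • n) * G₁⁻¹)⁻¹) +
      dist1 (U₁ * G₂ * expPoint (c₂ • n) * (U₁ * G₂)⁻¹ * (G₁ * expPoint (c₂ • n) * G₁⁻¹)⁻¹) +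
      dist1 (T₃ * G₃ * (expPoint (c₃ • n))⁻¹ * (T₃ * G₃)⁻¹ * (G₁ * (expPoint (c₃ • n))⁻¹ * G₁⁻¹)⁻¹) +
      dist1 (T₄ * G₄ * (expPoint (c₄ • n))⁻¹ * (T₄ * G₄)⁻¹ * (G₁ * (expPoint (c₄ • n))⁻¹ * G₁⁻¹)⁻¹) ≤
      2 * (|c₂| * dist1 (G₁⁻¹ * U₁ * G₂) + |c₃| * dist1 (G₁⁻¹ * T₃ * G₃) + |c₄| * dist1 (G₁⁻¹ * T₄ * G₄)) := by
    rw [t₁]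
    linarith [t₂.trans m₂, t₃.trans m₃, t₄.trans m₄]
  exact key

/-- ★★★ **FRAMED PLAQUETTE TRANSPORT — COST + TORQUE + FRAME DEFECT.**  If the four letters of `∂q` are left-translated by the framed
one-axis rotations `hᵢ = expPoint(cᵢ • Ad_{Gᵢ} n̂₀)` (`‖n̂₀‖ = 1`; nothing is assumed off `∂q`), then the plaquette's Wilson term changes by
`(1 − cos s)·reTr U(∂q) + sin s·⟨Ad_{G₁} n̂₀, imVec(su2Quat U(∂q))⟩`, `s = c₁ + c₂ − c₃ − c₄`, up to the FRAME DEFECT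
`2(|c₂|·dist1(G₁⁻¹U₁G₂) + |c₃|·dist1(G₁⁻¹(U₁U₂U₃⁻¹)G₃) + |c₄|·dist1(G₁⁻¹U(∂q)G₄))` — ✓`abs_wilsonTerm_plaq_sub_oneAxis_le` + §3.
[cite: Balaban1987RG1, (0.2) p.252; Balaban1989LargeFieldI, (1.77) p.194] -/
theorem abs_wilsonTerm_plaq_framed_sub_le {P : Params} {j : ℕ} {U U' : GaugeField P j SU2} (p : Plaq P j)
    (G₁ G₂ G₃ G₄ : SU2) {n : EuclideanSpace ℝ (Fin 3)} (hn : ‖n‖ = 1) (c₁ c₂ c₃ c₄ : ℝ)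
    (e₁ : U' (bond₁ p) = expPoint (c₁ • adSU2 G₁ n) * U (bond₁ p))
    (e₂ : U' (bond₂ p) = expPoint (c₂ • adSU2 G₂ n) * U (bond₂ p))
    (e₃ : U' (bond₃ p) = expPoint (c₃ • adSU2 G₃ n) * U (bond₃ p))
    (e₄ : U' (bond₄ p) = expPoint (c₄ • adSU2 G₄ n) * U (bond₄ p)) :
    |((1 - reTr (GaugeField.plaqHol U' p)) - (1 - reTr (GaugeField.plaqHol U p))) -
        ((1 - Real.cos (c₁ + c₂ - c₃ - c₄)) * reTr (GaugeField.plaqHol U p) +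
          Real.sin (c₁ + c₂ - c₃ - c₄) * ⟪adSU2 G₁ n, imVec (su2Quat (GaugeField.plaqHol U p))⟫)| ≤
      2 * (|c₂| * dist1 (G₁⁻¹ * U (bond₁ p) * G₂) +
        |c₃| * dist1 (G₁⁻¹ * (U (bond₁ p) * U (bond₂ p) * (U (bond₃ p))⁻¹) * G₃) +
        |c₄| * dist1 (G₁⁻¹ * GaugeField.plaqHol U p * G₄)) := by
  have hn' : ‖adSU2 G₁ n‖ = 1 := by rw [norm_adSU2_eq, hn]
  refine (abs_wilsonTerm_plaq_sub_oneAxis_le p e₁ e₂ e₃ e₄ hn' (c₁ + c₂ - c₃ - c₄)).trans ?_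
  rw [norm_su2Quat_sub_su2Quat]
  exact dist1_framedTransport_mul_inv_oneAxis_le _ _ _ _ _ _ _ hn _ _ _ _

end Framed

/-! ## §4 Frames from a gauge: the loops are the re-gauged letters; the reading covariance -/

section GaugeFramed

variable {P : Params} {j : ℕ}

/-- The three-letter path of `∂q` re-gauged: `U^u(b₁)·U^u(b₂)·U^u(b₃)⁻¹ = u(x)·(U₁U₂U₃⁻¹)·u(x+e_ν)⁻¹`
(the inner gauge factors cancel because `(x+e_μ)+e_ν = (x+e_ν)+e_μ`). [cite: Balaban1985Averaging, (8)-(9) p.19] -/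
theorem gaugeAct_threePath_eq (u : GaugeTransf P j SU2) (U : GaugeField P j SU2) (p : Plaq P j) :
    GaugeField.gaugeAct u U (bond₁ p) * GaugeField.gaugeAct u U (bond₂ p) * (GaugeField.gaugeAct u U (bond₃ p))⁻¹ =
      u p.src * (U (bond₁ p) * U (bond₂ p) * (U (bond₃ p))⁻¹) * (u (p.src.shift p.ν))⁻¹ := by
  simp only [GaugeField.gaugeAct, bond₁, bond₂, bond₃, PBond.tgt]
  rw [Site.shift_comm p.src p.ν p.μ]
  group

/-- ★★ **FRAMED PLAQUETTE TRANSPORT, FRAMES FROM A GAUGE.**  With frames `Gᵧ = u(y)⁻¹` read from a gauge transformation `u`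
(e.g. the axial/comb gauge of the sweep ball, `u(y)` = the transport from the centre to `y`), the translations on `∂q` are
`hᵢ = expPoint(cᵢ • Ad_{u(yᵢ)⁻¹} n̂₀)` (`yᵢ` = source of the `i`-th letter) and the frame defect is paid by the RE-GAUGED LETTERS:
`|Δ − [(1 − cos s)·reTr U(∂q) + sin s·⟨Ad_{u(x)⁻¹}n̂₀, imVec(su2Quat U(∂q))⟩]| ≤ 2(|c₂|·dist1(U^u(b₁)) + |c₃|·dist1(U^u(b₁)U^u(b₂)U^u(b₃)⁻¹) + |c₄|·dist1(U(∂q)))`.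
[cite: Balaban1985Averaging, (8)-(9) p.19; Balaban1989LargeFieldI, (1.77) p.194] -/
theorem abs_wilsonTerm_plaq_gaugeFramed_sub_le {U U' : GaugeField P j SU2} (u : GaugeTransf P j SU2) (p : Plaq P j)
    {n : EuclideanSpace ℝ (Fin 3)} (hn : ‖n‖ = 1) (c₁ c₂ c₃ c₄ : ℝ)
    (e₁ : U' (bond₁ p) = expPoint (c₁ • adSU2 (u p.src)⁻¹ n) * U (bond₁ p))
    (e₂ : U' (bond₂ p) = expPoint (c₂ • adSU2 (u (p.src.shift p.μ))⁻¹ n) * U (bond₂ p))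
    (e₃ : U' (bond₃ p) = expPoint (c₃ • adSU2 (u (p.src.shift p.ν))⁻¹ n) * U (bond₃ p))
    (e₄ : U' (bond₄ p) = expPoint (c₄ • adSU2 (u p.src)⁻¹ n) * U (bond₄ p)) :
    |((1 - reTr (GaugeField.plaqHol U' p)) - (1 - reTr (GaugeField.plaqHol U p))) -
        ((1 - Real.cos (c₁ + c₂ - c₃ - c₄)) * reTr (GaugeField.plaqHol U p) +
          Real.sin (c₁ + c₂ - c₃ - c₄) * ⟪adSU2 (u p.src)⁻¹ n, imVec (su2Quat (GaugeField.plaqHol U p))⟫)| ≤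
      2 * (|c₂| * dist1 (GaugeField.gaugeAct u U (bond₁ p)) +
        |c₃| * dist1 (GaugeField.gaugeAct u U (bond₁ p) * GaugeField.gaugeAct u U (bond₂ p) *
          (GaugeField.gaugeAct u U (bond₃ p))⁻¹) +
        |c₄| * dist1 (GaugeField.plaqHol U p)) := by
  have h := abs_wilsonTerm_plaq_framed_sub_le p (u p.src)⁻¹ (u (p.src.shift p.μ))⁻¹ (u (p.src.shift p.ν))⁻¹ (u p.src)⁻¹
    hn c₁ c₂ c₃ c₄ e₁ e₂ e₃ e₄
  have r₂ : ((u p.src)⁻¹)⁻¹ * U (bond₁ p) * (u (p.src.shift p.μ))⁻¹ = GaugeField.gaugeAct u U (bond₁ p) := by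
    rw [inv_inv]; rfl
  have r₃ : ((u p.src)⁻¹)⁻¹ * (U (bond₁ p) * U (bond₂ p) * (U (bond₃ p))⁻¹) * (u (p.src.shift p.ν))⁻¹ =
      GaugeField.gaugeAct u U (bond₁ p) * GaugeField.gaugeAct u U (bond₂ p) * (GaugeField.gaugeAct u U (bond₃ p))⁻¹ := by
    rw [inv_inv, gaugeAct_threePath_eq]
  have r₄ : dist1 (((u p.src)⁻¹)⁻¹ * GaugeField.plaqHol U p * (u p.src)⁻¹) = dist1 (GaugeField.plaqHol U p) := by
    rw [inv_inv]
    exact GaugeGroup.dist1_conj _ _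
  rw [r₂, r₃, r₄] at h
  exact h

/-- The same with the three loops bounded by link sizes: if every re-gauged letter of `∂q` is within `η` of `1`
(`dist1(U^u(bᵢ)) ≤ η`, `i = 1,2,3`) and `dist1(U(∂q)) ≤ η₄`, the frame defect is `≤ 2(|c₂|·η + 3|c₃|·η + |c₄|·η₄)`.
[cite: Balaban1985Averaging, (8)-(9) p.19] -/
theorem abs_wilsonTerm_plaq_gaugeFramed_sub_le_of_links {U U' : GaugeField P j SU2} (u : GaugeTransf P j SU2) (p : Plaq P j)
    {n : EuclideanSpace ℝ (Fin 3)} (hn : ‖n‖ = 1) (c₁ c₂ c₃ c₄ : ℝ)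
    (e₁ : U' (bond₁ p) = expPoint (c₁ • adSU2 (u p.src)⁻¹ n) * U (bond₁ p))
    (e₂ : U' (bond₂ p) = expPoint (c₂ • adSU2 (u (p.src.shift p.μ))⁻¹ n) * U (bond₂ p))
    (e₃ : U' (bond₃ p) = expPoint (c₃ • adSU2 (u (p.src.shift p.ν))⁻¹ n) * U (bond₃ p))
    (e₄ : U' (bond₄ p) = expPoint (c₄ • adSU2 (u p.src)⁻¹ n) * U (bond₄ p))
    {η η₄ : ℝ} (hη₁ : dist1 (GaugeField.gaugeAct u U (bond₁ p)) ≤ η) (hη₂ : dist1 (GaugeField.gaugeAct u U (bond₂ p)) ≤ η)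
    (hη₃ : dist1 (GaugeField.gaugeAct u U (bond₃ p)) ≤ η) (hη₄ : dist1 (GaugeField.plaqHol U p) ≤ η₄) :
    |((1 - reTr (GaugeField.plaqHol U' p)) - (1 - reTr (GaugeField.plaqHol U p))) -
        ((1 - Real.cos (c₁ + c₂ - c₃ - c₄)) * reTr (GaugeField.plaqHol U p) +
          Real.sin (c₁ + c₂ - c₃ - c₄) * ⟪adSU2 (u p.src)⁻¹ n, imVec (su2Quat (GaugeField.plaqHol U p))⟫)| ≤
      2 * (|c₂| * η + 3 * |c₃| * η + |c₄| * η₄) := by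
  refine (abs_wilsonTerm_plaq_gaugeFramed_sub_le u p hn c₁ c₂ c₃ c₄ e₁ e₂ e₃ e₄).trans ?_
  have h3 : dist1 (GaugeField.gaugeAct u U (bond₁ p) * GaugeField.gaugeAct u U (bond₂ p) *
      (GaugeField.gaugeAct u U (bond₃ p))⁻¹) ≤ 3 * η := by
    have := GaugeGroup.dist1_mul_le (GaugeField.gaugeAct u U (bond₁ p) * GaugeField.gaugeAct u U (bond₂ p))
      (GaugeField.gaugeAct u U (bond₃ p))⁻¹
    have h12 := GaugeGroup.dist1_mul_le (GaugeField.gaugeAct u U (bond₁ p)) (GaugeField.gaugeAct u U (bond₂ p))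
    rw [GaugeGroup.dist1_inv] at this
    linarith
  have s := add_le_add (add_le_add (mul_le_mul_of_nonneg_left hη₁ (abs_nonneg c₂))
    (mul_le_mul_of_nonneg_left h3 (abs_nonneg c₃))) (mul_le_mul_of_nonneg_left hη₄ (abs_nonneg c₄))
  have s2 := mul_le_mul_of_nonneg_left s (zero_le_two (α := ℝ))
  refine s2.trans (le_of_eq ?_)
  ring

/-- `(a·b).re = (b·a).re` in `ℍ`. [folklore] -/
private theorem re_mul_comm (a b : ℍ) : (a * b).re = (b * a).re := by
  simp only [Quaternion.re_mul]
  ring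

/-- ★ **READING COVARIANCE**: the torque in the transported frame is the reading, in the fixed frame `n̂₀`, of the element transported
back — `⟨Ad_G n̂₀, imVec(su2Quat W)⟩ = ⟨n̂₀, imVec(su2Quat(G⁻¹·W·G))⟩` (cyclicity of `Re` in `ℍ`). [cite: Balaban1989LargeFieldI, (1.77) p.194] -/
theorem inner_adSU2_imVec_su2Quat (G₀ W : SU2) (n : EuclideanSpace ℝ (Fin 3)) :
    ⟪adSU2 G₀ n, imVec (su2Quat W)⟫ = ⟪n, imVec (su2Quat (G₀⁻¹ * W * G₀))⟫ := by
  have h1 := re_imQuat_mul (adSU2 G₀ n) (su2Quat W)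
  have h2 := re_imQuat_mul n (su2Quat (G₀⁻¹ * W * G₀))
  have hinv : (su2Quat G₀)⁻¹ = su2Quat G₀⁻¹ := by
    symm
    apply eq_inv_of_mul_eq_one_left
    rw [← su2Quat_mul, inv_mul_cancel, su2Quat_one]
  have hc : (imQuat (adSU2 G₀ n) * su2Quat W).re = (imQuat n * su2Quat (G₀⁻¹ * W * G₀)).re := by
    rw [imQuat_adSU2, hinv, su2Quat_mul, su2Quat_mul]
    calc (su2Quat G₀ * imQuat n * su2Quat G₀⁻¹ * su2Quat W).re
        = (su2Quat G₀ * (imQuat n * su2Quat G₀⁻¹ * su2Quat W)).re := by simp only [mul_assoc]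
      _ = ((imQuat n * su2Quat G₀⁻¹ * su2Quat W) * su2Quat G₀).re := re_mul_comm _ _
      _ = (imQuat n * (su2Quat G₀⁻¹ * su2Quat W * su2Quat G₀)).re := by simp only [mul_assoc]
  linarith

/-- … in particular for frames from a gauge `u` (`G = u(x)⁻¹`): the torque at `q` is the `n̂₀`-reading of the re-gauged plaquette
`U^u(∂q) = u(x)·U(∂q)·u(x)⁻¹`. [cite: Balaban1985Averaging, (8)-(9) p.19] -/
theorem inner_adSU2_inv_imVec_su2Quat_plaqHol (u : GaugeTransf P j SU2) (U : GaugeField P j SU2) (p : Plaq P j)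
    (n : EuclideanSpace ℝ (Fin 3)) :
    ⟪adSU2 (u p.src)⁻¹ n, imVec (su2Quat (GaugeField.plaqHol U p))⟫ =
      ⟪n, imVec (su2Quat (GaugeField.plaqHol (GaugeField.gaugeAct u U) p))⟫ := by
  rw [inner_adSU2_imVec_su2Quat, inv_inv, T4WilsonGaugeFlatDirection.plaqHol_gaugeAct]

end GaugeFramed

end Summit.QuantumFields.YangMills.Theorems.CovariantDischargeFramedPlaquetteTransport

end
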